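import Literature.MathematicalPhysics.QuantumFieldTheory.BalabanImbrieJaffe1984to88.BIJ88RestrictionsAllOrders308
import Literature.MathematicalPhysics.QuantumFieldTheory.BalabanImbrieJaffe1984to88.BIJ88InterpolatedRestrictions308
import Mathlib.Analysis.Calculus.IteratedDeriv.FaaDiBruno
import Mathlib.Analysis.Calculus.ContDiff.Deriv
import Mathlib.Analysis.SpecialFunctions.Log.Deriv

/-!
# `BalabanImbrieJaffe1984to88.BIJ88LogZt308` — T. Bałaban, J. Imbrie, A. Jaffe, *Effective action and cluster properties of the
abelian Higgs model*, Commun. Math. Phys. **114** (1988) 257–315 [BalabanImbrieJaffe1988]: Sect. 5.14, p. 308 [PDF 52], verbatim: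
*"Thus the restrictions and the interactions disappear at t = 0, at which point we have a purely Gaussian expectation. Thus we define
perturbative terms for the action, 𝒫_{k+1}(Λ₁₂^{(k)}) = Σ_{α=1}^{n̄} −(1/α!)(dᵅ/dtᵅ) log z_t(Λ₁₂^{(k)})|_{t=0}"* (5.14.1) — the
t-DERIVATIVES OF `log z_t` for the restriction factor `z(t) = ∫ χ′_{Λ,t} dP`, `χ′_{Λ,t} = Π_{b∈B} χ(c_b·p(te_k), Φ_b)`.

statement-level skeleton of published theorems with citation tags; proofs where landed; nothing here is a claim about the Yang–Mills mass gap

ERRATUM (v1.1, docstring only; referee ref-1 gen 27/28, render `lit-balaban-r16/renders/cmp114/original-p052-x2.png`): print's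
(5.14.1) carries a leading MINUS — 𝒫_{k+1}(Λ₁₂^{(k)}) = Σ_{α=1}^{n̄} −(1/α!)(dᵅ/dtᵅ) log z_t(Λ₁₂^{(k)})|_{t=0} — and so does the
remainder (5.14.2), ℛ_k(Λ₁₂^{(k)}) = ∫₀¹ dt −((1−t)^{n̄}/(n̄+1)!)⟨d/dt; …; d/dt⟩_t; the v1 quotation dropped the sign.  Declarations are
unchanged (the minus lives inside `BIJ88Perturbative341.pertPart`).

WHAT THIS FILE ADDS to this seat's p. 308 chain (`BIJ88InterpolatedRestrictions308`: `z′ = ⟨∂_tχ′⟩`, `z(t) → 1`;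
`BIJ88RestrictionsAllOrders308`: `z^{(n)} = ⟨∂ⁿ_tχ′⟩`, `z^{(n)}(t) → 0` under Gaussian marginals).  The perturbative terms (5.14.1) are
derivatives of `log z_t`; here:

* **§1 `z` is `C^∞` on the branch** `(0, e^{−1}/e_k)` for ANY finite measure and measurable fields (`contDiffOn_integral_prod_cutoff_t`,
  every order `n : ℕ`; from the all-orders exchange of `d/dt` and `∫`).
* **§2 Faà di Bruno for `log z_t`** — wherever `z(t) ≠ 0` on the branch,
  `(d/dt)^i log z_t = Σ_{c ∈ OrderedFinpartition i} log^{(|c|)}(z_t) · Π_j z^{(|c_j|)}(t)` (`iteratedDeriv_log_integral_prod_cutoff_t_eq_sum`,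
  Mathlib's one-dimensional Faà di Bruno formula `iteratedDeriv_comp_eq_sum_orderedFinpartition`).
* **§3 the restriction factor contributes nothing to (5.14.1) at `t = 0⁺`** — with CENTERED Gaussian marginals (Mathlib `HasGaussianLaw`,
  variances `≤ v`), positive thresholds `c_b ≥ c₀ > 0`, `p > 1/2`, `e_k > 0`: `log z_t → 0` and, for EVERY `α ≥ 1`,
  `(dᵅ/dtᵅ) log z_t → 0` as `t → 0⁺` (`tendsto_log_integral_prod_cutoff_t_zero`, `tendsto_iteratedDeriv_log_integral_prod_cutoff_t_zero`):
  every Faà di Bruno term carries at least one factor `z^{(m)}(t) → 0`, `m ≥ 1`, against the bounded `log^{(|c|)}(z_t) → log^{(|c|)}(1)`.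

PDF held: `paper:balaban1988-cmp114-bij-abelian-higgs-effective-action` (journal page = PDF page + 256); p. 308 [PDF 52].

CITATION HEADER (lean-in-tree rule).  Part of the lit-balaban TYPED SKELETON (HOME `run/shared/lean/pub/lit-balaban/`), Phase 2,
seat p36 (gen 7, unit `lit-balaban-p36`); row **C2.Eq5.14.1-5.14.2** of `HOME/lit-balaban-r16/ROWS-C2-part2.md` (owner r16; typed leaf
`Eq5141` untouched).  Theorems only; no definitions, no `Prop` facts; axioms standard.
-/

namespace Literature.MathematicalPhysics.QuantumFieldTheory.BalabanImbrieJaffe1984to88.BIJ88LogZt308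

open MeasureTheory ProbabilityTheory Filter Set
open BIJ88Sect2Statements (pLog eK)
open BIJ88Sect5Statements (CutoffProfile cutoff)
open scoped Topology

/-! ## §1 `z` is smooth on the branch `(0, e^{−1}/e_k)` -/

section Smooth

variable (χ : CutoffProfile) {ι Ω : Type*} [MeasurableSpace Ω]

/-- Every expectation `t ↦ ∫ (d/dt)^m χ′_{Λ,t} dμ` is `Cⁿ` on the branch, for all `n m : ℕ` (induction on `n` across all `m`: its derivative
is the expectation of the (m+1)-st derivative, `BIJ88RestrictionsAllOrders308`). [cite: BalabanImbrieJaffe1988, (5.14.3) p.309] -/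
theorem contDiffOn_integral_iteratedDeriv_prod_cutoff_t (p : ℝ) (μ : Measure Ω) [IsFiniteMeasure μ] (B : Finset ι)
    {Φ : ι → Ω → ℝ} (hΦ : ∀ b ∈ B, Measurable (Φ b)) {c : ι → ℝ} (hc : ∀ b ∈ B, c b ≠ 0) {ek : ℝ} (hek : 0 < ek) (n m : ℕ) :
    ContDiffOn ℝ n (fun t => ∫ ω, iteratedDeriv m (fun s => ∏ b ∈ B, cutoff χ (c b * pLog p (s * ek)) (Φ b ω)) t ∂μ)
      (Set.Ioo 0 (Real.exp (-1) / ek)) := by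
  have hbr : ∀ t ∈ Set.Ioo 0 (Real.exp (-1) / ek), t * ek < Real.exp (-1) := fun t ht => by
    rw [← lt_div_iff₀ hek]; exact ht.2
  have hdiff : ∀ m : ℕ, DifferentiableOn ℝ
      (fun t => ∫ ω, iteratedDeriv m (fun s => ∏ b ∈ B, cutoff χ (c b * pLog p (s * ek)) (Φ b ω)) t ∂μ)
      (Set.Ioo 0 (Real.exp (-1) / ek)) := fun m t ht =>
    (BIJ88RestrictionsAllOrders308.hasDerivAt_integral_iteratedDeriv_prod_cutoff_t χ p μ B hΦ hc hek ht.1 (hbr t ht)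
      m).2.differentiableAt.differentiableWithinAt
  induction n generalizing m with
  | zero =>
    rw [Nat.cast_zero, contDiffOn_zero]
    exact (hdiff m).continuousOn
  | succ n ih =>
    rw [Nat.cast_succ, contDiffOn_succ_iff_deriv_of_isOpen isOpen_Ioo]
    refine ⟨hdiff m, fun h => absurd h (by exact_mod_cast WithTop.natCast_ne_top n), ?_⟩
    refine (ih (m + 1)).congr fun t ht => ?_
    exact (BIJ88RestrictionsAllOrders308.hasDerivAt_integral_iteratedDeriv_prod_cutoff_t χ p μ B hΦ hc hek ht.1 (hbr t ht)
      m).2.deriv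

/-- **`z(t) = ∫ χ′_{Λ,t} dμ` is `Cⁿ` on the branch `(0, e^{−1}/e_k)` for every `n`**, for ANY finite measure and measurable fields.
[cite: BalabanImbrieJaffe1988, (5.14.3) p.309] -/
theorem contDiffOn_integral_prod_cutoff_t (p : ℝ) (μ : Measure Ω) [IsFiniteMeasure μ] (B : Finset ι) {Φ : ι → Ω → ℝ}
    (hΦ : ∀ b ∈ B, Measurable (Φ b)) {c : ι → ℝ} (hc : ∀ b ∈ B, c b ≠ 0) {ek : ℝ} (hek : 0 < ek) (n : ℕ) :
    ContDiffOn ℝ n (fun t => ∫ ω, ∏ b ∈ B, cutoff χ (c b * pLog p (t * ek)) (Φ b ω) ∂μ) (Set.Ioo 0 (Real.exp (-1) / ek)) := by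
  have h := contDiffOn_integral_iteratedDeriv_prod_cutoff_t χ p μ B hΦ hc hek n 0
  simpa only [iteratedDeriv_zero] using h

/-- … hence `C^n` at every point of the branch. [cite: BalabanImbrieJaffe1988, (5.14.3) p.309] -/
theorem contDiffAt_integral_prod_cutoff_t (p : ℝ) (μ : Measure Ω) [IsFiniteMeasure μ] (B : Finset ι) {Φ : ι → Ω → ℝ}
    (hΦ : ∀ b ∈ B, Measurable (Φ b)) {c : ι → ℝ} (hc : ∀ b ∈ B, c b ≠ 0) {ek : ℝ} (hek : 0 < ek) (n : ℕ) {t : ℝ} (ht : 0 < t)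
    (h1 : t * ek < Real.exp (-1)) :
    ContDiffAt ℝ n (fun t => ∫ ω, ∏ b ∈ B, cutoff χ (c b * pLog p (t * ek)) (Φ b ω) ∂μ) t :=
  (contDiffOn_integral_prod_cutoff_t χ p μ B hΦ hc hek n).contDiffAt
    (isOpen_Ioo.mem_nhds ⟨ht, by rwa [lt_div_iff₀ hek]⟩)

end Smooth

/-! ## §2 Faà di Bruno for `log z_t` -/

section FaaDiBruno

variable (χ : CutoffProfile) {ι Ω : Type*} [MeasurableSpace Ω]

/-- **`(d/dt)^i log z_t` by Faà di Bruno**: on the branch, wherever `z(t) ≠ 0`,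
`(d/dt)^i log z(t) = Σ_{c : OrderedFinpartition i} log^{(|c|)}(z(t)) · Π_{j} z^{(|c_j|)}(t)`.
[cite: BalabanImbrieJaffe1988, (5.14.1) p.308] -/
theorem iteratedDeriv_log_integral_prod_cutoff_t_eq_sum (p : ℝ) (μ : Measure Ω) [IsFiniteMeasure μ] (B : Finset ι)
    {Φ : ι → Ω → ℝ} (hΦ : ∀ b ∈ B, Measurable (Φ b)) {c : ι → ℝ} (hc : ∀ b ∈ B, c b ≠ 0) {ek : ℝ} (hek : 0 < ek) (i : ℕ)
    {t : ℝ} (ht : 0 < t) (h1 : t * ek < Real.exp (-1))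
    (hz : (∫ ω, ∏ b ∈ B, cutoff χ (c b * pLog p (t * ek)) (Φ b ω) ∂μ) ≠ 0) :
    iteratedDeriv i (fun t => Real.log (∫ ω, ∏ b ∈ B, cutoff χ (c b * pLog p (t * ek)) (Φ b ω) ∂μ)) t =
      ∑ c' : OrderedFinpartition i,
        iteratedDeriv c'.length Real.log (∫ ω, ∏ b ∈ B, cutoff χ (c b * pLog p (t * ek)) (Φ b ω) ∂μ) *
          ∏ j, iteratedDeriv (c'.partSize j) (fun t => ∫ ω, ∏ b ∈ B, cutoff χ (c b * pLog p (t * ek)) (Φ b ω) ∂μ) t := by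
  have hf := contDiffAt_integral_prod_cutoff_t χ p μ B hΦ hc hek i ht h1
  have hg : ContDiffAt ℝ (i : WithTop ℕ∞) Real.log (∫ ω, ∏ b ∈ B, cutoff χ (c b * pLog p (t * ek)) (Φ b ω) ∂μ) :=
    Real.contDiffAt_log.mpr hz
  exact iteratedDeriv_comp_eq_sum_orderedFinpartition (g := Real.log) hg hf le_rfl

end FaaDiBruno

/-! ## §3 Gaussian marginals: `(dᵅ/dtᵅ) log z_t → 0` as `t → 0⁺` for every `α` -/

section Gaussian

variable (χ : CutoffProfile) {ι Ω : Type*} [MeasurableSpace Ω]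

/-- `log^{(m)}` is continuous at `1` (log is smooth away from `0`). [cite: BalabanImbrieJaffe1988, (5.14.1) p.308] -/
theorem continuousAt_iteratedDeriv_log_one (m : ℕ) : ContinuousAt (iteratedDeriv m Real.log) 1 := by
  have hO : IsOpen (Set.Ioi (0 : ℝ)) := isOpen_Ioi
  have hcd : ContDiffOn ℝ (m : WithTop ℕ∞) Real.log (Set.Ioi 0) :=
    Real.contDiffOn_log.mono fun x hx => ne_of_gt hx
  have hcont : ContinuousOn (iteratedDerivWithin m Real.log (Set.Ioi 0)) (Set.Ioi 0) :=
    hcd.continuousOn_iteratedDerivWithin le_rfl hO.uniqueDiffOn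
  have hcont' : ContinuousOn (iteratedDeriv m Real.log) (Set.Ioi 0) :=
    hcont.congr fun x hx => (iteratedDerivWithin_of_isOpen hO hx).symm
  exact hcont'.continuousAt (Ioi_mem_nhds one_pos)

/-- **Order 0: `log z_t → 0` as `t → 0⁺`** (probability measure, positive thresholds, `p > 0`).
[cite: BalabanImbrieJaffe1988, (5.14.2) p.308] -/
theorem tendsto_log_integral_prod_cutoff_t_zero {p : ℝ} (hp : 0 < p) (P : Measure Ω) [IsProbabilityMeasure P] (B : Finset ι)
    {Φ : ι → Ω → ℝ} (hΦ : ∀ b ∈ B, Measurable (Φ b)) {c : ι → ℝ} (hc : ∀ b ∈ B, 0 < c b) {ek : ℝ} (hek : 0 < ek) :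
    Tendsto (fun t => Real.log (∫ ω, ∏ b ∈ B, cutoff χ (c b * pLog p (t * ek)) (Φ b ω) ∂P)) (𝓝[>] (0 : ℝ)) (𝓝 0) := by
  have hz := BIJ88InterpolatedRestrictions308.tendsto_integral_prod_cutoff_t_one χ hp P B hΦ hc hek
  have hlog : Tendsto Real.log (𝓝 1) (𝓝 0) := by
    have := (Real.continuousAt_log one_ne_zero).tendsto
    rwa [Real.log_one] at this
  exact hlog.comp hz

/-- **The restriction factor contributes nothing to the perturbative terms (5.14.1) at `t = 0⁺`.**  With CENTERED Gaussian marginals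
(any probability space, Mathlib `HasGaussianLaw`, variances `≤ v`, `0 < v`), positive thresholds `c_b ≥ c₀ > 0`, exponent `p > 1/2` and
`e_k > 0`: for EVERY `α ≥ 1`, `(dᵅ/dtᵅ) log z_t → 0` as `t → 0⁺`, where `z_t = ∫ Π_b χ(c_b·p(te_k), Φ_b) dP`.
[cite: BalabanImbrieJaffe1988, (5.14.1) p.308] -/
theorem tendsto_iteratedDeriv_log_integral_prod_cutoff_t_zero {p : ℝ} (hp : 1 / 2 < p) (P : Measure Ω) [IsProbabilityMeasure P]
    (B : Finset ι) {Φ : ι → Ω → ℝ} (hG : ∀ b ∈ B, HasGaussianLaw (Φ b) P) (hΦ : ∀ b ∈ B, Measurable (Φ b))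
    (h0 : ∀ b ∈ B, P[Φ b] = 0) {v : ℝ} (hv : 0 < v) (hvar : ∀ b ∈ B, Var[Φ b; P] ≤ v) {c : ι → ℝ} {c₀ : ℝ} (hc₀ : 0 < c₀)
    (hcb : ∀ b ∈ B, c₀ ≤ c b) {ek : ℝ} (hek : 0 < ek) {α : ℕ} (hα : 1 ≤ α) :
    Tendsto (fun t => iteratedDeriv α (fun t => Real.log (∫ ω, ∏ b ∈ B, cutoff χ (c b * pLog p (t * ek)) (Φ b ω) ∂P)) t)
      (𝓝[>] (0 : ℝ)) (𝓝 0) := by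
  have hp0 : 0 < p := by linarith
  have hcpos : ∀ b ∈ B, 0 < c b := fun b hb => hc₀.trans_le (hcb b hb)
  have hcne : ∀ b ∈ B, c b ≠ 0 := fun b hb => (hcpos b hb).ne'
  have hcabs : ∀ b ∈ B, c₀ ≤ |c b| := fun b hb => (hcb b hb).trans (le_abs_self _)
  set z : ℝ → ℝ := fun t => ∫ ω, ∏ b ∈ B, cutoff χ (c b * pLog p (t * ek)) (Φ b ω) ∂P with hzdef
  -- z → 1, hence eventually z ≠ 0, and the branch is a neighbourhood of 0⁺
  have hz1 : Tendsto z (𝓝[>] (0 : ℝ)) (𝓝 1) :=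
    BIJ88InterpolatedRestrictions308.tendsto_integral_prod_cutoff_t_one χ hp0 P B hΦ hcpos hek
  have hzne : ∀ᶠ t in 𝓝[>] (0 : ℝ), z t ≠ 0 :=
    (hz1.eventually (lt_mem_nhds (by norm_num : (1 : ℝ) / 2 < 1))).mono fun t ht h => by rw [h] at ht; linarith
  have hbranch : ∀ᶠ t in 𝓝[>] (0 : ℝ), t * ek < Real.exp (-1) := by
    have : Tendsto (fun t : ℝ => t * ek) (𝓝[>] (0 : ℝ)) (𝓝 0) := by
      have h := (tendsto_id.mul_const ek : Tendsto (fun t : ℝ => t * ek) (𝓝 0) (𝓝 (0 * ek)))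
      rw [zero_mul] at h
      exact h.mono_left nhdsWithin_le_nhds
    exact this.eventually (gt_mem_nhds (Real.exp_pos _))
  have hpos : ∀ᶠ t in 𝓝[>] (0 : ℝ), (0 : ℝ) < t := eventually_nhdsWithin_of_forall fun t ht => ht
  -- every Faà di Bruno term tends to 0
  have hterm : ∀ c' : OrderedFinpartition α,
      Tendsto (fun t => iteratedDeriv c'.length Real.log (z t) * ∏ j, iteratedDeriv (c'.partSize j) z t)
        (𝓝[>] (0 : ℝ)) (𝓝 0) := by
    intro c'
    have hlog : Tendsto (fun t => iteratedDeriv c'.length Real.log (z t)) (𝓝[>] (0 : ℝ))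
        (𝓝 (iteratedDeriv c'.length Real.log 1)) :=
      (continuousAt_iteratedDeriv_log_one c'.length).tendsto.comp hz1
    have hprod : Tendsto (fun t => ∏ j, iteratedDeriv (c'.partSize j) z t) (𝓝[>] (0 : ℝ)) (𝓝 0) := by
      have h := tendsto_finsetProd (Finset.univ : Finset (Fin c'.length))
        (f := fun j t => iteratedDeriv (c'.partSize j) z t) (a := fun _ => (0 : ℝ)) (x := 𝓝[>] (0 : ℝ))
        fun j _ => BIJ88RestrictionsAllOrders308.tendsto_iteratedDeriv_integral_prod_cutoff_t_zero χ hp P B hG hΦ h0 hv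
          hvar hc₀ hcabs hek (c'.partSize_pos j)
      rwa [Finset.prod_const, Finset.card_univ, Fintype.card_fin, zero_pow (c'.length_pos (by omega)).ne'] at h
    simpa using hlog.mul hprod
  have hsum : Tendsto (fun t => ∑ c' : OrderedFinpartition α,
      iteratedDeriv c'.length Real.log (z t) * ∏ j, iteratedDeriv (c'.partSize j) z t) (𝓝[>] (0 : ℝ)) (𝓝 0) := by
    have h := tendsto_finsetSum (Finset.univ : Finset (OrderedFinpartition α)) fun c' _ => hterm c'
    simpa using h
  -- the iterated derivative of log z equals the Faà di Bruno sum eventually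
  refine hsum.congr' ?_
  filter_upwards [hzne, hbranch, hpos] with t hzt h1 ht0
  exact (iteratedDeriv_log_integral_prod_cutoff_t_eq_sum χ p P B hΦ hcne hek α ht0 h1 hzt).symm

end Gaussian

end Literature.MathematicalPhysics.QuantumFieldTheory.BalabanImbrieJaffe1984to88.BIJ88LogZt308
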